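import Summits.BirchSwinnertonDyer.BirchSwinnertonDyer.Theorems.EisensteinPrimesAcTwistDeformationCurveAlmostDivisible
import Summits.BirchSwinnertonDyer.BirchSwinnertonDyer.Theorems.UniversalToricDescentThinCombNoPseudoNullOfPoitouTate
import Summits.BirchSwinnertonDyer.BirchSwinnertonDyer.Theorems.EisensteinPrimesGreenbergCorankAlgebra
import Summits.BirchSwinnertonDyer.BirchSwinnertonDyer.Theorems.EisensteinPrimesXAcImprimitiveNoPTorsion
import HarnessLib

/-!
# Crux 4 `BSDpOnCellC`: the prop411 DROP, file 1 (of 8) — Prop. 4.1.1 (c) at the curve deformation `𝐃_E` for `𝓛^{v̄}`, (N1)^{Sf} and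
# Keller–Yin Thm. 1.4.1's λ-identity, with Greenberg 2016 Prop. 4.1.1 REPLACED by Milne ADT I Thm. 4.10 (a)
# (helper, `--supports stmt-BirchSwinnertonDyer-19034`; width seat `bsd-line-x2-p2` gen 18)

PART A (namespace `…Theorems.AcTwistDeformation`) re-types the two theorems of
`Theorems/EisensteinPrimesAcTwistDeformationCurveAlmostDivisible.lean` §2–§3 (x2-p2 g7) in which the research-grade named fact
`Greenberg2016.prop411_selmer_isAlmostDivisible` (Prop. 4.1.1, every case / field / `Λ`) was APPLIED — once, in case (c) at `η = 𝔭`,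
`Λ = R = ℤ_p⟦T⟧`, `K` imaginary quadratic — with that binder REPLACED by the TEXTBOOK statement
`hX : poitouTate_shaRestricted_tateDual_natural_at K S` (Milne, *Arithmetic Duality Theorems*, I Thm. 4.10 (a) at the finite `S`; the x1
lane's END-theorem shape, a conjunct of crux 4's `stub_publishedFacts` already): Prop. 4.1.1 (c)'s conclusion is the tree theorem
`Greenberg2016.selmer_isAlmostDivisible_caseC_of_prop321_of_isCotorsion_H_two'` (cell `pub/bsd-wall`, p728036) granted [Gr5] Prop. 3.2.1 (c)
at the totally complex `K`, i.e. `UniversalToricDescentThinComb.NoPseudoNullOfPoitouTate.prop321_caseC_of_poitouTateAt hX` (p714471 / p728414);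
`H²(K_Σ/K, 𝐃)` cotorsion = corank `0` (the squeeze `bigRep_leo_crk_strictAt_of_dualBasis`) + cofinite generation (Greenberg 2006 Prop. 3.2).
LOC⁽²⁾ / LEO are no longer consumed, so the `K̄ˣ` dual-basis binders `jU hinjU hsurjU` leave. The move is the x1 lane's (w5 g12, p731265).
PART B (namespace `…Theorems.XAcImprimitiveNoPTorsion`) re-types `xAc_smul_eq_zero_imp_of_facts` / `lambdaInvariant_xAc_eq_add_of_not_split_of_facts`
(x2-p2 g7) with `h411 ↦ (hX : ∀ L [IsTotallyComplex L] S, S.Finite → poitouTate_… L S)` at the same position, proofs token-identical but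
for the one call into PART A.

* `AcTwistDeformation.bigRep_strictAtSelmer_isAlmostDivisible_of_dualBasis_ofPoitouTateAt`, `….primaryTorsion_strictAtSelmer_isAlmostDivisible_ofPoitouTateAt`;
* `XAcImprimitiveNoPTorsion.xAc_smul_eq_zero_imp_ofPoitouTateAt`, `….lambdaInvariant_xAc_eq_add_of_not_split_ofPoitouTateAt`.

HONEST FRAMING: by-name bookkeeping; Greenberg 2016 Prop. 4.1.1 in general is NOT proved — its consumed instance follows from a
textbook statement already on the line's list. No summit statement / crux / stub proved; BSD proved for no curve. THEOREMS ONLY.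
References: [Greenberg2016Selmer] Prop. 4.1.1 (c), Prop. 4.2.2, §4.3; [Greenberg2010] Prop. 3.2.1 (c); [Greenberg2006] Props. 3.2, 4.1, 4.2,
§5 A, Prop. 6.10; [MilneADT2006] I Thm. 4.10 (a); [CastellaGrossiLeeSkinner2022] Cor. 1.4.3; [KellerYin2024] Thm. 1.4.1 (shape only).
-/


set_option autoImplicit false
set_option linter.dupNamespace false -- the summit namespace `…BirchSwinnertonDyer.BirchSwinnertonDyer.Theorems` (Sub = Summit, D-0017) trips it

noncomputable section

open scoped Classical
open NumberField IsDedekindDomain Field Finset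
open Literature.NumberTheory.EllipticCurves Literature.NumberTheory.GaloisRepresentations
  Literature.NumberTheory.GaloisCohomology
  Literature.NumberTheory.IwasawaTheory Literature.NumberTheory.IwasawaTheory.Greenberg2016
  Literature.NumberTheory.IwasawaTheory.Greenberg2006
  Summit.BirchSwinnertonDyer.BirchSwinnertonDyer.Theorems.TwistDeformationCofree
  Summit.BirchSwinnertonDyer.BirchSwinnertonDyer.Theorems.GreenbergFullAtSelmer
  Summit.BirchSwinnertonDyer.BirchSwinnertonDyer.Theorems.SignedBaseChangeAcDivGreenbergSqueeze

namespace Summit.BirchSwinnertonDyer.BirchSwinnertonDyer.Theorems.AcTwistDeformation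

/-! ## §1 Dual-basis form -/

section DualBasisForm

variable {K : Type} [Field K] [NumberField K] {S : Set (HeightOneSpectrum (𝓞 K))} {p : ℕ} [Fact p.Prime]
  {A : Type} [AddCommGroup A] [Module ℤ_[p] A] [TopologicalSpace A] [DiscreteTopology A]
  [TopologicalSpace (PowerSeries ℤ_[p])] [IsTopologicalRing (PowerSeries ℤ_[p])]
  [IsTopologicalAddGroup (BigRepModule ℤ_[p] p A)]
  [ContinuousSMul (PowerSeries ℤ_[p]) (BigRepModule ℤ_[p] p A)]
  (hS : ∀ v : HeightOneSpectrum (𝓞 K), ((p : ℕ) : 𝓞 K) ∈ v.asIdeal → v ∈ S)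
  (κ : ZpExtension K p) (ρ₀ : ContinuousRep (GaloisGroupUnramifiedOutside K S) ℤ_[p] A) {n : ℕ}

/-- **Greenberg 2016 Prop. 4.1.1 (c) for `𝓛^{v̄}` at the one-variable twist deformation `𝐃 = bigRep κ ρ₀` — CONCLUSION, with
Prop. 4.1.1 BY NAME replaced by the textbook statement `hX : poitouTate_shaRestricted_tateDual_natural_at K S`** (twin of
`bigRep_strictAtSelmer_isAlmostDivisible_of_dualBasis`): `A` `p`-primary with a rank-`n` Pontryagin dual-basis family over
`ℚ/ℤ`, `K` imaginary quadratic, `p = v v̄`, `S ⊇ {v, v̄}` finite with local `h⁰ = 0` and LOC⁽¹⁾ on `S`; for ANY `L` with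
`L w = if w = v̄ then ⊥ else ⊤` and `corank_Λ S_L(K, 𝐃) = 0`, `S_L(K, 𝐃)` is almost `Λ`-divisible. Discharged as in the twin
(RFX / cofree / cofinite generation / `p`-primarity, CRK and `h² = 0` by the squeeze, "`𝓛^{v̄}` almost divisible" by Prop.
4.2.2 + §5 A, (c) at `η = v`), the last step being `selmer_isAlmostDivisible_caseC_of_prop321_of_isCotorsion_H_two'` fed
`prop321_caseC_of_poitouTateAt hX`. [cite: Greenberg2016Selmer, Prop. 4.1.1 (c) (§4.1 p. 15 L21–32), Prop. 4.2.2 (§4.2 p. 20 L4–8), §4.3 p. 20 L19–30]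
[cite: Greenberg2010, Prop. 3.2.1 (c) (p. 15)] [cite: Greenberg2006, Prop. 3.2, Props. 4.1–4.2, §5 A, Prop. 6.10] [cite: MilneADT2006, I Thm. 4.10 (a) (p. 57)] -/
theorem bigRep_strictAtSelmer_isAlmostDivisible_of_dualBasis_ofPoitouTateAt
    (hX : poitouTate_shaRestricted_tateDual_natural_at K S)
    (h41 : prop41_globalEulerPoincareCorank) (h42 : prop42_localEulerPoincareCorank)
    (h32 : prop32_cohomology_isCofinitelyGenerated)
    (hSf : S.Finite) (hK : IsImaginaryQuadratic K) (hA : ∀ a : A, ∃ k : ℕ, p ^ k • a = 0)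
    (jQ : Fin n → (A →+ AddCircle (1 : ℚ)))
    (hinjQ : ∀ c : Fin n → ℤ_[p], (∀ a : A, ∑ k, jQ k (c k • a) = 0) → c = 0)
    (hsurjQ : ∀ φ : A →+ AddCircle (1 : ℚ), ∃ c : Fin n → ℤ_[p], ∀ a : A, φ a = ∑ k, jQ k (c k • a))
    (h0loc : ∀ v : HeightOneSpectrum (𝓞 K), v ∈ S →
      HasCorank (PowerSeries ℤ_[p])
        ((localRep S (bigRep (κ.liftUnramifiedOutside S hS) ρ₀) (Sum.inr v)).H 0) 0)
    (hLOC1fin : ∀ v : HeightOneSpectrum (𝓞 K), v ∈ S →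
      LOC1 S (bigRep (κ.liftUnramifiedOutside S hS) ρ₀) (Sum.inr v))
    {𝔭 𝔭bar : HeightOneSpectrum (𝓞 K)} (hne : 𝔭bar ≠ 𝔭)
    (hp𝔭 : ((p : ℕ) : 𝓞 K) ∈ 𝔭.asIdeal) (hp𝔭bar : ((p : ℕ) : 𝓞 K) ∈ 𝔭bar.asIdeal)
    (L : Specification S (bigRep (κ.liftUnramifiedOutside S hS) ρ₀))
    (hL : ∀ w : Place K, L w = if w = Sum.inr 𝔭bar then ⊥ else ⊤)
    (hSel : HasCorank (PowerSeries ℤ_[p]) L.selmer 0) :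
    IsAlmostDivisible (PowerSeries ℤ_[p]) L.selmer := by
  -- standing clauses of the arena at `Λ = R = ℤ_p⟦T⟧`
  have hΛ := nonempty_iwasawaAlgebra_ringEquiv_mvPowerSeries p
  have hcpl := isAdicComplete_maximalIdeal_iwasawaAlgebra p
  have hres := finite_residueField_iwasawaAlgebra p
  have hchar := charP_residueField_iwasawaAlgebra p
  have hinjΛ : Function.Injective (algebraMap (PowerSeries ℤ_[p]) (PowerSeries ℤ_[p])) :=
    fun a b h ↦ by simpa using h
  have hfin : Module.Finite (PowerSeries ℤ_[p]) (PowerSeries ℤ_[p]) := inferInstance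
  have hlin : ∀ (g : GaloisGroupUnramifiedOutside K S) (r : PowerSeries ℤ_[p]) (d : BigRepModule ℤ_[p] p A),
      bigRep (κ.liftUnramifiedOutside S hS) ρ₀ g (r • d) = r • bigRep (κ.liftUnramifiedOutside S hS) ρ₀ g d :=
    fun g r d ↦ map_smul (bigRep (κ.liftUnramifiedOutside S hS) ρ₀ g) r d
  -- the instance data from the dual bases
  have hT := isCofree_bigRepModule_pi hA jQ hinjQ hsurjQ
  have hcf := isCofinitelyGenerated_bigRepModule_pi hA jQ hinjQ hsurjQ
  have hRFX := rfx_bigRepModule_pi hA jQ hinjQ hsurjQ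
  have hpD : ∀ d : BigRepModule ℤ_[p] p A, ∃ n : ℕ, (p ^ n : ℤ) • d = 0 := exists_zpow_smul_eq_zero
  haveI := hK.2
  have hKc : ∀ w : InfinitePlace K, w.IsComplex := IsTotallyComplex.isComplex
  -- LEO and CRK by the squeeze
  obtain ⟨-, hCRK, -, hH2⟩ := bigRep_leo_crk_strictAt_of_dualBasis hS κ ρ₀ h41 h42 h32 hSf hK hA jQ hinjQ hsurjQ
    h0loc hLOC1fin hne hp𝔭 hp𝔭bar L hL hSel
  -- "`𝓛^{v̄}` almost divisible": Prop. 4.2.2 + §5 A at the finite places, `H¹(ℂ, ·) = 0` at the archimedean ones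
  have hLad : L.IsAlmostDivisible :=
    strictAt_isAlmostDivisible L hL
      (fun w hw _ ↦ top_isAlmostDivisible_of_facts prop422_localCohomology_isAlmostDivisible_holds
        sec5A_localH2_subsingleton_of_LOC1_holds hSf hS hΛ hinjΛ hfin hcpl hres hchar hlin hT hcf hpD hRFX hw
        (hLOC1fin w hw))
      (fun w ↦ subsingleton_localH1_inl_of_isComplex S (bigRep (κ.liftUnramifiedOutside S hS) ρ₀) (hKc w))
  -- `H²(K_Σ/K, 𝐃)` is cotorsion: cofinitely generated (Prop. 3.2) of corank `0` (the squeeze)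
  have hH2cot : IsCotorsion (PowerSeries ℤ_[p]) ((bigRep (κ.liftUnramifiedOutside S hS) ρ₀).H 2) :=
    isCotorsion_of_isCofinitelyGenerated_of_hasCorank_zero
      (h32.global hSf hS hΛ (bigRep (κ.liftUnramifiedOutside S hS) ρ₀) hpD hcf 2) hH2
  -- Prop. 4.1.1 (c)'s CONCLUSION at `η = 𝔭` from [Gr5] Prop. 3.2.1 (c) at `K` (road «SUR-Λ» fed the textbook `hX`)
  exact selmer_isAlmostDivisible_caseC_of_prop321_of_isCotorsion_H_two' S (bigRep (κ.liftUnramifiedOutside S hS) ρ₀)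
    (UniversalToricDescentThinComb.NoPseudoNullOfPoitouTate.prop321_caseC_of_poitouTateAt hSf hS hX)
    hSf hS hΛ hfin hT hpD L hRFX hH2cot (hS 𝔭 hp𝔭) (hLOC1fin 𝔭 (hS 𝔭 hp𝔭)) hLad hCRK
    (isCoreflexive_Q_strictAt_of_ne L hL (fun h ↦ hne.symm (Sum.inr_injective h)))

end DualBasisForm

/-! ## §2 The curve: `A = E[p^∞]`, `n = 2` -/

section Curve

variable {K : Type} [Field K] [NumberField K] {S : Set (HeightOneSpectrum (𝓞 K))} {p : ℕ} [Fact p.Prime]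
  (W : WeierstrassCurve K) [W.IsElliptic]
  [TopologicalSpace (PowerSeries ℤ_[p])] [IsTopologicalRing (PowerSeries ℤ_[p])]
  [IsTopologicalAddGroup (BigRepModule ℤ_[p] p (PrimaryTorsion W.geomPoints p))]
  [ContinuousSMul (PowerSeries ℤ_[p]) (BigRepModule ℤ_[p] p (PrimaryTorsion W.geomPoints p))]
  (hS : ∀ v : HeightOneSpectrum (𝓞 K), ((p : ℕ) : 𝓞 K) ∈ v.asIdeal → v ∈ S)
  (κ : ZpExtension K p)
  (ρ₀ : ContinuousRep (GaloisGroupUnramifiedOutside K S) ℤ_[p] (PrimaryTorsion W.geomPoints p))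

/-- **`S_{𝓛^{v̄}}(K, 𝐃_E)` IS ALMOST `Λ`-DIVISIBLE with Greenberg 2016 Prop. 4.1.1 BY NAME replaced by the textbook statement
`hX : poitouTate_shaRestricted_tateDual_natural_at K S`** (twin of `primaryTorsion_strictAtSelmer_isAlmostDivisible`): for an
elliptic `W/K`, `K` imaginary quadratic, `p = v v̄`, `S ⊇ {w ∣ p}` finite with a `σ`-supply, ANY continuous `ℤ_p`-linear `ρ₀`
of `G_{K,S}` on `E[p^∞]`, ANY `L` with `L w = if w = v̄ then ⊥ else ⊤` and `corank_Λ S_L(K, 𝐃_E) = 0`: every Pontryagin dual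
of `S_L(K, 𝐃_E)` has no non-zero pseudo-null `Λ`-submodule, GRANTED Greenberg 2006 Props. 4.1, 4.2, 3.2 by name and Milne
I 4.10 (a) at `(K, S)`. [cite: Greenberg2016Selmer, Prop. 4.1.1 (c) (§4.1 p. 15 L21–32), §4.3 pp. 20–21] [cite: MilneADT2006, I Thm. 4.10 (a) (p. 57)]
[cite: Greenberg2006, Props. 3.2, 4.1, 4.2, §5 A] [cite: CastellaGrossiLeeSkinner2022, Cor. 1.4.3] -/
theorem primaryTorsion_strictAtSelmer_isAlmostDivisible_ofPoitouTateAt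
    (hX : poitouTate_shaRestricted_tateDual_natural_at K S)
    (h41 : prop41_globalEulerPoincareCorank) (h42 : prop42_localEulerPoincareCorank)
    (h32 : prop32_cohomology_isCofinitelyGenerated)
    (hSf : S.Finite) (hK : IsImaginaryQuadratic K)
    (hsup : ∀ v : HeightOneSpectrum (𝓞 K), v ∈ S →
      ∃ σ : absoluteGaloisGroup (Place.Completion (Sum.inr v : Place K)),
        κ (absGaloisRestrict K _ σ) ≠ 1)
    {𝔭 𝔭bar : HeightOneSpectrum (𝓞 K)} (hne : 𝔭bar ≠ 𝔭)
    (hp𝔭 : ((p : ℕ) : 𝓞 K) ∈ 𝔭.asIdeal) (hp𝔭bar : ((p : ℕ) : 𝓞 K) ∈ 𝔭bar.asIdeal)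
    (L : Specification S (bigRep (κ.liftUnramifiedOutside S hS) ρ₀))
    (hL : ∀ w : Place K, L w = if w = Sum.inr 𝔭bar then ⊥ else ⊤)
    (hSel : HasCorank (PowerSeries ℤ_[p]) L.selmer 0) :
    IsAlmostDivisible (PowerSeries ℤ_[p]) L.selmer := by
  obtain ⟨hA, jQ, -, hinjQ, hsurjQ, -, -⟩ := exists_dualBases_primaryTorsion W p
  have hloc := fun v (hv : v ∈ S) ↦
    localH0_and_LOC1_primaryTorsion S W hS κ ρ₀ (Sum.inr v) (hsup v hv).choose (hsup v hv).choose_spec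
  exact bigRep_strictAtSelmer_isAlmostDivisible_of_dualBasis_ofPoitouTateAt hS κ ρ₀ hX h41 h42 h32 hSf hK hA jQ hinjQ
    hsurjQ (fun v hv ↦ (hloc v hv).1) (fun v hv ↦ (hloc v hv).2) hne hp𝔭 hp𝔭bar L hL hSel

end Curve

end Summit.BirchSwinnertonDyer.BirchSwinnertonDyer.Theorems.AcTwistDeformation

end

/-! # PART B -/


set_option autoImplicit false
set_option linter.dupNamespace false -- the summit namespace `…BirchSwinnertonDyer.BirchSwinnertonDyer.Theorems` (Sub = Summit, D-0017) trips it

noncomputable section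

open scoped Classical
open NumberField IsDedekindDomain Field Multiplicative PowerSeries WeierstrassCurve
open Literature.NumberTheory.EllipticCurves Literature.NumberTheory.EllipticCurves.GreenbergSelmer
  Literature.NumberTheory.EllipticCurves.GreenbergVatsal2000 Literature.NumberTheory.GaloisRepresentations
  Literature.NumberTheory.EllipticCurves.KellerYin2024 Literature.NumberTheory.EllipticCurves.IwasawaDual
  Literature.NumberTheory.EllipticCurves.Castella2018.AcSelmer Literature.NumberTheory.EllipticCurves.Rank1Residual
  Literature.NumberTheory.EllipticCurves.CastellaGrossiLeeSkinner2022
  Literature.NumberTheory.IwasawaTheory Literature.NumberTheory.IwasawaTheory.Greenberg2016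
  Literature.NumberTheory.IwasawaTheory.Greenberg2006
  Summit.BirchSwinnertonDyer.BirchSwinnertonDyer.Theorems.GreenbergFullAtSelmer
  Summit.BirchSwinnertonDyer.BirchSwinnertonDyer.Theorems.AcTwistDeformationResidualPair
  Summit.BirchSwinnertonDyer.BirchSwinnertonDyer.Theorems.AcTwistDeformation

namespace Summit.BirchSwinnertonDyer.BirchSwinnertonDyer.Theorems.XAcImprimitiveNoPTorsion

variable {K : Type} [Field K] [NumberField K] {p : ℕ} [Fact p.Prime]

/-! ## §1 No `p`-torsion in `𝔛^{Sf}_f` -/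

/-- **[prop411-DROP twin: `(h411 : prop411_selmer_isAlmostDivisible)` ↦ the textbook clause `hX` (Milne ADT I Thm. 4.10 (a)); the original docstring follows with that substitution.]** **(N1)^{Sf} — `𝔛^{Sf}_f` HAS NO `p`-TORSION, with Greenberg 2016 Prop. 4.1.1 BY NAME replaced by Milne ADT I Thm. 4.10 (a)
(`hX`)** (twin of `xAc_smul_eq_zero_imp_of_facts`): `E = W/ℚ` over the imaginary quadratic `K` with (Heeg) for `N_E`,
`2 < p = v v̄`, `κ` anticyclotomic with generator `γ`, `Sf` the places over `N_E` off `p`, `𝔛^{Sf}_f` finitely generated torsion with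
`μ = 0`; GRANTED Greenberg 2006 Props. 4.1, 4.2, 3.2 by name and `hX`. [cite: Greenberg2016Selmer, Prop. 4.1.1 (c) (§4.1 p. 15 L21–32), §4.3 pp. 20–21]
[cite: Greenberg2006, Thm. 3, Props. 3.2, 4.1, 4.2, §5 A] [cite: MilneADT2006, I Thm. 4.10 (a) (p. 57)] [cite: CastellaGrossiLeeSkinner2022, Cor. 1.4.3]
[cite: KellerYin2024, §1.4 (e) (arXiv:2402.12781v2 TeX L1162–1181)] [cite: PollackWeston2011, App. A Prop. A.2] -/
theorem xAc_smul_eq_zero_imp_ofPoitouTateAt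
    (hX : ∀ (L : Type) [Field L] [NumberField L] [IsTotallyComplex L] (S : Set (HeightOneSpectrum (𝓞 L))),
      S.Finite → Literature.NumberTheory.GaloisCohomology.poitouTate_shaRestricted_tateDual_natural_at L S)
    (h41 : prop41_globalEulerPoincareCorank) (h42 : prop42_localEulerPoincareCorank)
    (h32 : prop32_cohomology_isCofinitelyGenerated)
    (W : WeierstrassCurve ℚ) [W.IsElliptic] (hp : 2 < p) (hK : IsImaginaryQuadratic K)
    (hH : SatisfiesHeegnerHypothesis (W.conductorNorm ℤ) K)
    {v vbar : HeightOneSpectrum (𝓞 K)} (hv : ((p : ℕ) : 𝓞 K) ∈ v.asIdeal)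
    (hvbar : ((p : ℕ) : 𝓞 K) ∈ vbar.asIdeal) (hne : vbar ≠ v)
    (κ : ZpExtension K p) (hκ : κ.IsAnticyclotomic) (γ : absoluteGaloisGroup K) [Fact (κ.IsTopGenerator γ)]
    (Sf : Finset (HeightOneSpectrum (𝓞 K)))
    (hSf : ∀ w : HeightOneSpectrum (𝓞 K), w ∈ Sf ↔
      (((W.conductorNorm ℤ : ℤ) : 𝓞 K) ∈ w.asIdeal ∧ ((p : ℕ) : 𝓞 K) ∉ w.asIdeal))
    (hXfin : Module.Finite (IwasawaAlgebra p) (XAc (W.baseChange K) p κ vbar (↑Sf : Set (HeightOneSpectrum (𝓞 K))) γ))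
    (hXtor : Module.IsTorsion (IwasawaAlgebra p) (XAc (W.baseChange K) p κ vbar (↑Sf : Set (HeightOneSpectrum (𝓞 K))) γ))
    (hμ : muInvariant p (XAc (W.baseChange K) p κ vbar (↑Sf : Set (HeightOneSpectrum (𝓞 K))) γ) = 0)
    (x : XAc (W.baseChange K) p κ vbar (↑Sf : Set (HeightOneSpectrum (𝓞 K))) γ) (hx : p • x = 0) : x = 0 := by
  haveI hEK : (W.baseChange K).IsElliptic := inferInstanceAs (W.map (algebraMap ℚ K)).IsElliptic
  -- `S = {v, v̄} ∪ Sf` contains the places above `p` and the bad places of `E_K`; `S ∩ {w ∤ p} = Sf`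
  set S : Set (HeightOneSpectrum (𝓞 K)) := (↑(insert v (insert vbar Sf)) : Set (HeightOneSpectrum (𝓞 K))) with hSdef
  have hS : ∀ w : HeightOneSpectrum (𝓞 K), ((p : ℕ) : 𝓞 K) ∈ w.asIdeal → w ∈ S :=
    mem_insert_insert_of_natCast_mem hK hv hvbar hne Sf
  have hSfS : ∀ w ∈ Sf, w ∈ S := fun w hw ↦ by
    rw [hSdef, Finset.coe_insert, Finset.coe_insert]
    exact Or.inr (Or.inr (Finset.mem_coe.mpr hw))
  have hSf₁ : (↑Sf : Set (HeightOneSpectrum (𝓞 K))) ⊆ S := fun w hw ↦ hSfS w (Finset.mem_coe.mp hw)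
  have hSf₂ : ∀ w ∈ S, ((p : ℕ) : 𝓞 K) ∉ w.asIdeal → w ∈ (↑Sf : Set (HeightOneSpectrum (𝓞 K))) := by
    intro w hw hpw
    rw [hSdef, Finset.coe_insert, Finset.coe_insert] at hw
    rcases hw with rfl | rfl | hw
    · exact absurd hv hpw
    · exact absurd hvbar hpw
    · exact hw
  have hgoodN : ∀ w : HeightOneSpectrum (𝓞 K), ((W.conductorNorm ℤ : ℤ) : 𝓞 K) ∉ w.asIdeal →
      (W.baseChange K).HasGoodReductionAt w := fun w hw ↦
    EisensteinPrimesMuLambda.hasGoodReductionAt_baseChange_of_conductorNorm_notMem W w hw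
  have hSbad : ∀ w : HeightOneSpectrum (𝓞 K), ¬ (W.baseChange K).HasGoodReductionAt w → w ∈ S := by
    intro w hw
    have hN : ((W.conductorNorm ℤ : ℤ) : 𝓞 K) ∈ w.asIdeal := by_contra fun h ↦ hw (hgoodN w h)
    by_cases hpw : ((p : ℕ) : 𝓞 K) ∈ w.asIdeal
    · exact hS w hpw
    · exact hSfS w ((hSf w).mpr ⟨hN, hpw⟩)
  have hgood : ∀ w : HeightOneSpectrum (𝓞 K), w ∉ S → ((p : ℕ) : 𝓞 K) ∉ w.asIdeal →
      (W.baseChange K).HasGoodReductionAt w := fun w hw _ ↦ by_contra fun h ↦ hw (hSbad w h)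
  -- the model `ρ₀` of `E_K[p^∞]` over `G_{K,S}` (Néron–Ogg–Shafarevich)
  have hNS : ∀ n ∈ ramificationSubgroup K S, ∀ P : PrimaryTorsion (W.baseChange K).geomPoints p, n • P = P :=
    fun n hn P ↦ SignedBaseChangeAcDivCurveModel.smul_primaryTorsion_eq_of_mem_ramificationSubgroup
      (W.baseChange K) p S hSbad hS hn P
  obtain ⟨ρ₀, hρ₀⟩ := SignedBaseChangeAcDivCurveModel.exists_continuousRep_primaryTorsion (W.baseChange K) p S hNS
  -- the canonical (discrete) topological instances of the arena
  letI tΛ : TopologicalSpace (PowerSeries ℤ_[p]) := ⊥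
  haveI : DiscreteTopology (PowerSeries ℤ_[p]) := ⟨rfl⟩
  haveI : IsTopologicalRing (PowerSeries ℤ_[p]) := inferInstance
  haveI : IsTopologicalAddGroup (BigRepModule ℤ_[p] p (PrimaryTorsion (W.baseChange K).geomPoints p)) :=
    inferInstance
  haveI : ContinuousSMul (PowerSeries ℤ_[p]) (BigRepModule ℤ_[p] p (PrimaryTorsion (W.baseChange K).geomPoints p)) :=
    inferInstance
  -- `K` imaginary quadratic; the `σ`-supply on `S` (class field theory above `p`, Brink + (Heeg) at `Sf`)
  haveI := hK.2
  have hKc : ∀ w : InfinitePlace K, w.IsComplex := IsTotallyComplex.isComplex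
  have hsup : ∀ w : HeightOneSpectrum (𝓞 K), w ∈ S →
      ∃ σ : absoluteGaloisGroup (Place.Completion (Sum.inr w : Place K)), κ (absGaloisRestrict K _ σ) ≠ 1 := by
    intro w hw
    refine exists_local_apply_ne_one_of_mem_or hK hp hH κ hκ w ?_
    rw [hSdef, Finset.coe_insert, Finset.coe_insert] at hw
    rcases hw with rfl | rfl | hw
    · exact Or.inl hv
    · exact Or.inl hvbar
    · exact Or.inr ((hSf w).mp (Finset.mem_coe.mp hw)).1
  -- the Shapiro descent with `ψ = id`
  let ψ : PrimaryTorsion (W.baseChange K).geomPoints p ≃+ (W.baseChange K).geomPrimaryTorsion p := AddEquiv.refl _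
  have hψ : ∀ (σ : absoluteGaloisGroup K) (a : PrimaryTorsion (W.baseChange K).geomPoints p),
      ψ (ρ₀ (toUnramifiedQuot K S σ) a) = σ • ψ a := fun σ a ↦ by rw [hρ₀]; rfl
  obtain ⟨F, hF⟩ := exists_shapiroDescent S hS κ ρ₀ ψ hψ
  -- the specification `𝓛^{v̄}` ("`0` at `v̄`, `⊤` elsewhere"), as a term (no definition)
  let L : Specification S (bigRep (κ.liftUnramifiedOutside S hS) ρ₀) := fun w ↦ if w = Sum.inr vbar then ⊥ else ⊤
  have hL : ∀ w : Place K, L w = if w = Sum.inr vbar then ⊥ else ⊤ := fun w ↦ rfl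
  -- corank `0`, Prop. 4.1.1 (c), Shapiro + duality
  have hSel := hasCorank_strictAtSelmer_zero_of_xAc S (W.baseChange K) hS κ ρ₀ hρ₀ hKc hvbar
    (↑Sf : Set (HeightOneSpectrum (𝓞 K))) hSf₁ hSf₂ hgood hF L hL hXfin hXtor
  have hAD := primaryTorsion_strictAtSelmer_isAlmostDivisible_ofPoitouTateAt (W.baseChange K) hS κ ρ₀
    (hX K S (Finset.finite_toSet _)) h41 h42 h32 (Finset.finite_toSet _) hK hsup hne hv hvbar L hL hSel
  exact xAc_eq_zero_of_smul_eq_zero_of_isAlmostDivisible S (W.baseChange K) hS κ ρ₀ hρ₀ hKc hvbar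
    (↑Sf : Set (HeightOneSpectrum (𝓞 K))) hSf₁ hSf₂ hgood hF L hL hAD hXfin hXtor hμ x hx

/-! ## §2 The λ-identity with equality -/

/-- **[prop411-DROP twin: `(h411 : prop411_selmer_isAlmostDivisible)` ↦ the textbook clause `hX` (Milne ADT I Thm. 4.10 (a)); the original docstring follows with that substitution.]** **`λ(𝔛^{Sf}_f) = λ(𝔛^{Sf}_{θsub}) + λ(𝔛^{Sf}_{θquot})` at every NON-SPLIT multiplicative Eisenstein datum and every residual pair,
with Greenberg 2016 Prop. 4.1.1 BY NAME replaced by Milne ADT I Thm. 4.10 (a) (`hX`)** (twin of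
`lambdaInvariant_xAc_eq_add_of_not_split_of_facts`; same binders otherwise, same proof with §1's twin).
[cite: KellerYin2024, Thm. 1.4.1, Lemma 5.1.1 and §5.1 (arXiv:2402.12781v2 TeX L1087–1098, L1744–1778)]
[cite: CastellaGrossiLeeSkinner2022, §1.2 Prop. 1.2.5, Prop. 14, Cor. 1.2.6, §1.4 Props. 1.4.1–1.4.2, Cor. 1.4.3]
[cite: Greenberg2016Selmer, Prop. 4.1.1 (c)] [cite: Greenberg2006, Props. 3.2, 4.1, 4.2] [cite: MilneADT2006, I Thm. 4.10 (a)] -/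
theorem lambdaInvariant_xAc_eq_add_of_not_split_ofPoitouTateAt
    (hprop125 : prop125_characterGrSelmerDual_torsion_muZero_dim) (hfact : prop14_residualCharacterSelmer_finite)
    (hlift : cor126_residualCharacter_globalLift) (hlocal : cor126_residualCharacter_localSurjective)
    (hX : ∀ (L : Type) [Field L] [NumberField L] [IsTotallyComplex L] (S : Set (HeightOneSpectrum (𝓞 L))),
      S.Finite → Literature.NumberTheory.GaloisCohomology.poitouTate_shaRestricted_tateDual_natural_at L S) (h41 : prop41_globalEulerPoincareCorank)
    (h42 : prop42_localEulerPoincareCorank) (h32 : prop32_cohomology_isCofinitelyGenerated)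
    (W : WeierstrassCurve ℚ) [W.IsElliptic] [W.IsGloballyMinimal]
    (K : Type) [Field K] [NumberField K] {v : HeightOneSpectrum (𝓞 K)} (vbar : HeightOneSpectrum (𝓞 K))
    (κ : ZpExtension K p) (γ : absoluteGaloisGroup K) [Fact (κ.IsTopGenerator γ)]
    (Sf : Finset (HeightOneSpectrum (𝓞 K)))
    (hp2 : 2 < p) (hmult : Mult W p) (hns : ¬ W.HasSplitMultiplicativeReductionAtPrime p) (hred : Red W p)
    (hK : IsImaginaryQuadratic K) (hH : SatisfiesHeegnerHypothesis (W.conductorNorm ℤ) K)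
    (hsplit : ((Ideal.span {(p : ℤ)}).primesOver (𝓞 K)).ncard = 2)
    (hv : ((p : ℕ) : 𝓞 K) ∈ v.asIdeal) (hvbar : ((p : ℕ) : 𝓞 K) ∈ vbar.asIdeal) (hne : vbar ≠ v) (hκ : κ.IsAnticyclotomic)
    (hSf : ∀ w : HeightOneSpectrum (𝓞 K), w ∈ Sf ↔
      (((W.conductorNorm ℤ : ℤ) : 𝓞 K) ∈ w.asIdeal ∧ ((p : ℕ) : 𝓞 K) ∉ w.asIdeal))
    (θsub θquot : FramedGaloisRep K (padicCoeffIntegers (∅ : Set (PadicAlgCl p))) 1)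
    (hpair : IsResidualPairOver (W.baseChange K) p θsub θquot)
    (Dsub : GrDualData κ (charModule (∅ : Set (PadicAlgCl p)) θsub) vbar (↑Sf : Set (HeightOneSpectrum (𝓞 K))) γ)
    (Dquot : GrDualData κ (charModule (∅ : Set (PadicAlgCl p)) θquot) vbar (↑Sf : Set (HeightOneSpectrum (𝓞 K))) γ) :
    lambdaInvariant p (XAc (W.baseChange K) p κ vbar (↑Sf : Set (HeightOneSpectrum (𝓞 K))) γ) =
      lambdaInvariant p Dsub.X + lambdaInvariant p Dquot.X := by
  obtain ⟨hXfin, hXtor, hμ⟩ := xAc_moduleFinite_isTorsion_muInvariant_of_prop14_of_not_split hfact W K vbar κ γ Sf hp2 hmult hns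
    hred hK hH hsplit hvbar hκ hSf
  exact (ResidualDevissageNonsplitLambdaIdentityAtNonsplit.lambdaInvariant_le_add_of_isResidualPairOver_of_not_split hprop125
    hlift hlocal W K vbar κ γ Sf hp2 hmult hns hK hH hsplit hvbar hκ hSf θsub θquot hpair Dsub Dquot).2.2
    (fun x hx ↦ xAc_smul_eq_zero_imp_ofPoitouTateAt hX h41 h42 h32 W hp2 hK hH hv hvbar hne κ hκ γ Sf hSf hXfin hXtor hμ x hx)

end Summit.BirchSwinnertonDyer.BirchSwinnertonDyer.Theorems.XAcImprimitiveNoPTorsion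

end
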